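import Literature.AlgebraicGeometry.Resolution.DiffIdealStalk
import Literature.AlgebraicGeometry.Resolution.DerivativeIdealsBlowup
import Literature.AlgebraicGeometry.Resolution.SharpOrderCoordinateCentre
import HarnessLib

/-!
# `Diff^{≤ n}(𝓘)` under inverse images and at points: restriction to opens, chart criterion, order drop

Topic `Literature/AlgebraicGeometry/Resolution`; companion of `DiffIdealSheaf.lean` (the ideal sheaves
`Diff^{≤ n}(𝓘) = diffIdealSheaf φ n 𝓘` on a scheme with `K`-structure `φ` whose affine pieces are of finite type over
the field `K`; sections `Diff^{≤ n}(𝓘)(U) = Diff^{≤ n}(𝓘(U))`) and `DiffIdealStalk.lean` (stalks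
`Diff^{≤ n}(𝓘)_x = Diff^{≤ n}(𝓘_x)`). PROVED here:

* `comap_diffIdealSheaf_le_of_charts` — **chart criterion** for `f⁻¹ Diff^{≤n}(𝓘)·𝒪_X ⊆ Diff^{≤n}(f⁻¹𝓘·𝒪_X)` along a
  morphism `f : X → Y` (induced `K`-structure `f^* ∘ φ` on `X`): it suffices that `X` is covered by affine opens `V`
  over affine opens `U` of `Y` on which `Diff^{≤n}(𝓘(U)) · Γ(X, V) ⊆ Diff^{≤n}(𝓘(U) · Γ(X, V))` (inverse images and
  `Diff^{≤ n}` are computed sectionwise: `ideal_comap_of_le`, `diffIdealSheaf_ideal`);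
* `map_diffIdeal_le_of_algEquiv_comp` — the ring-level hypothesis is stable under composition with `K`-algebra
  isomorphisms (`diffIdeal_map_algEquiv`);
* `comap_diffIdealSheaf_le_of_isOpenImmersion` — **restriction to an open**: for an open immersion `j : U → W`,
  `Diff^{≤n}(𝓘)|_U ⊆ Diff^{≤n}(𝓘|_U)` (EGA IV₄ (16.8.1): «pour tout ouvert `U` de `X`, `D|U` … est aussi un opérateur
  différentiel d'ordre `≤ n`»);
* `natCast_sub_le_idealOrder_diffIdealSheaf` — **order drop**: `ord_x Diff^{≤n}(𝓘) ≥ ord_x 𝓘 − n`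
  (`Diff^{≤n}(𝓘)_x = Diff^{≤n}(𝓘_x) ⊆ 𝔪_x^{b−n}` when `𝓘_x ⊆ 𝔪_x^b`, `diffIdeal_le_pow_sub`; Villamayor:
  «`V(Diff^{b−1}(I))` is the set of points of order `≥ b`»).

Consumers (index only): the Differentiation Theorem of [Hironaka2005] Thm 3.4 / Hironaka 2017 Th. 3.1 along LSBs
(`Literature/AlgebraicGeometry/Hironaka2017/…`).

## Sources

* A. Grothendieck, J. Dieudonné, ÉGA IV₄, Publ. Math. IHÉS 32 (1967), (16.8.1), Prop. 16.8.6, 16.8.8. [EGAIV4]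
* O. Villamayor U., *Rees algebras on smooth schemes: integral closure and higher differential operators*,
  Rev. Mat. Iberoam. 24 (2008), §4.1. [VillamayorU2008ReesDiff]
-/

noncomputable section

open CategoryTheory AlgebraicGeometry TopologicalSpace Opposite

namespace Literature.AlgebraicGeometry.Resolution

universe u v

/-! ## Ring level: the extension property is stable under `K`-algebra isomorphisms -/

section Ring

variable (K : Type v) [Field K] {A B₀ B : Type*} [CommRing A] [CommRing B₀] [CommRing B] [Algebra K B₀]
  [Algebra K B]

/-- If `ψ = e ∘ ψ₀` for a `K`-algebra isomorphism `e : B₀ ≅ B`, then `(P·B₀)·e = P·B` (plumbing). [folklore] -/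
private theorem map_map_eq_map_of_comp (ψ₀ : A →+* B₀) (ψ : A →+* B) (e : B₀ ≃ₐ[K] B)
    (he : ∀ a, e (ψ₀ a) = ψ a) (P : Ideal A) : (P.map ψ₀).map e = P.map ψ := by
  apply le_antisymm
  · rw [Ideal.map_le_iff_le_comap, Ideal.map_le_iff_le_comap]
    intro r hr
    rw [Ideal.mem_comap, Ideal.mem_comap, he]
    exact Ideal.mem_map_of_mem _ hr
  · rw [Ideal.map_le_iff_le_comap]
    intro r hr
    rw [Ideal.mem_comap, ← he]
    exact Ideal.mem_map_of_mem e (Ideal.mem_map_of_mem _ hr)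

/-- **`Diff^{≤n}(P)·B ⊆ Diff^{≤n}(P·B)` is stable under `K`-isomorphisms of the target**: if `ψ : A → B` factors as
`e ∘ ψ₀` with `e : B₀ ≅ B` a `K`-algebra isomorphism and `Diff^{≤n}_K(P)·B₀ ⊆ Diff^{≤n}_K(P·B₀)`, then
`Diff^{≤n}_K(P)·B ⊆ Diff^{≤n}_K(P·B)` (`Diff^{≤ n}` commutes with `K`-algebra isomorphisms).
[cite: EGAIV4, Déf. 16.8.1 / Prop. 16.8.8 (b) (functoriality of Diff^n under isomorphisms)] -/
theorem map_diffIdeal_le_of_algEquiv_comp [Algebra K A] (ψ₀ : A →+* B₀) (ψ : A →+* B) (e : B₀ ≃ₐ[K] B)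
    (he : ∀ a, e (ψ₀ a) = ψ a) {n : ℕ} {P : Ideal A}
    (h : (diffIdeal K n P).map ψ₀ ≤ diffIdeal K n (P.map ψ₀)) :
    (diffIdeal K n P).map ψ ≤ diffIdeal K n (P.map ψ) := by
  rw [← map_map_eq_map_of_comp K ψ₀ ψ e he, ← map_map_eq_map_of_comp K ψ₀ ψ e he P,
    ← diffIdeal_map_algEquiv]
  exact Ideal.map_mono h

end Ring

/-! ## Sheaf level: the chart criterion and restriction to opens -/

section Sheaf

variable {K : Type v} [Field K] {X Y : Scheme.{u}} (f : X ⟶ Y) {φ : K →+* Γ(Y, ⊤)}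

/-- **Chart criterion for `f⁻¹ Diff^{≤n}(𝓘)·𝒪_X ⊆ Diff^{≤n}(f⁻¹𝓘·𝒪_X)`**: let `f : X → Y`, `Y` with `K`-structure
`φ` and `X` with the induced one, both with finite-type sections over the field `K`. If `X` is covered by affine
opens `V j` lying over affine opens `U j` of `Y` such that on each chart
`Diff^{≤n}(𝓘(U j)) · Γ(X, V j) ⊆ Diff^{≤n}(𝓘(U j) · Γ(X, V j))` (along `f^* : Γ(Y, U j) → Γ(X, V j)`), then the inverse
image ideal sheaf of `Diff^{≤n}(𝓘)` is contained in `Diff^{≤n}` of the inverse image of `𝓘` (both sides are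
computed sectionwise on the charts). [cite: EGAIV4, Prop. 16.8.6 p.41 with (16.8.1) p.40 (quasi-coherence of Diff^n; affine-local content)] -/
theorem comap_diffIdealSheaf_le_of_charts (hY : HasFiniteTypeSections φ)
    (hX : HasFiniteTypeSections (f.appTop.hom.comp φ)) {ι : Type*} (U : ι → Y.affineOpens)
    (V : ι → X.affineOpens) (hVU : ∀ j, (V j : X.Opens) ≤ f ⁻¹ᵁ (U j : Y.Opens))
    (hcov : ⨆ j, (V j : X.Opens) = ⊤) (n : ℕ) (I : Y.IdealSheafData)
    (hchart : ∀ j,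
      letI := sectionsAlgebra φ (U j)
      letI := sectionsAlgebra (f.appTop.hom.comp φ) (V j)
      (diffIdeal K n (I.ideal (U j))).map (f.appLE (U j) (V j) (hVU j)).hom ≤
        diffIdeal K n ((I.ideal (U j)).map (f.appLE (U j) (V j) (hVU j)).hom)) :
    (diffIdealSheaf φ n I).comap f ≤ diffIdealSheaf (f.appTop.hom.comp φ) n (I.comap f) := by
  refine Scheme.IdealSheafData.le_of_iSup_eq_top V hcov fun j => ?_
  letI := sectionsAlgebra φ (U j)
  letI := sectionsAlgebra (f.appTop.hom.comp φ) (V j)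
  rw [ideal_comap_of_le f _ (U j) (V j) (hVU j), diffIdealSheaf_ideal hY, diffIdealSheaf_ideal hX,
    ideal_comap_of_le f _ (U j) (V j) (hVU j)]
  exact hchart j

variable {f} in
/-- **Restriction of `Diff^{≤n}(𝓘)` to an open**: for an open immersion `j : U → W` (induced `K`-structure on
`U`, finite-type sections), `j⁻¹ Diff^{≤n}(𝓘)·𝒪_U ⊆ Diff^{≤n}(j⁻¹𝓘·𝒪_U)` — on an affine open `V′ ⊆ j(U)` of `W`
both sides are `Diff^{≤n}(𝓘(V′))` transported along `Γ(W, V′) ≅ Γ(U, j⁻¹V′)`.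
[cite: EGAIV4, (16.8.1) p.40 («pour tout ouvert U de X, D|U … est aussi un opérateur différentiel d'ordre ≤ n»)] -/
theorem comap_diffIdealSheaf_le_of_isOpenImmersion {U W : Scheme.{u}} (j : U ⟶ W) [IsOpenImmersion j]
    {φ : K →+* Γ(W, ⊤)} (hW : HasFiniteTypeSections φ) (hU : HasFiniteTypeSections (j.appTop.hom.comp φ))
    (n : ℕ) (J : W.IdealSheafData) :
    (diffIdealSheaf φ n J).comap j ≤ diffIdealSheaf (j.appTop.hom.comp φ) n (J.comap j) := by
  -- charts: affine opens `V' ⊆ j(U)` of `W` and their preimages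
  let ι := {V' : W.affineOpens // (V' : W.Opens) ≤ j.opensRange}
  let Uc : ι → W.affineOpens := fun p => p.1
  let Vc : ι → U.affineOpens := fun p => ⟨j ⁻¹ᵁ (p.1 : W.Opens), p.1.2.preimage_of_isOpenImmersion j p.2⟩
  have hVU : ∀ p : ι, (Vc p : U.Opens) ≤ j ⁻¹ᵁ (Uc p : W.Opens) := fun p => le_rfl
  have hcov : ⨆ p, (Vc p : U.Opens) = ⊤ := by
    refine top_le_iff.mp fun x _ => ?_
    obtain ⟨V', hV', hxV', hV'U⟩ := exists_isAffineOpen_mem_and_subset (X := W) (x := j x)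
      (U := j.opensRange) ⟨x, rfl⟩
    exact Opens.mem_iSup.mpr ⟨⟨⟨V', hV'⟩, hV'U⟩, hxV'⟩
  refine comap_diffIdealSheaf_le_of_charts j hW hU Uc Vc hVU hcov n J fun p => ?_
  letI := sectionsAlgebra φ (Uc p)
  letI := sectionsAlgebra (j.appTop.hom.comp φ) (Vc p)
  -- the chart map `j^* : Γ(W, V') → Γ(U, j⁻¹ V')` is a `K`-algebra isomorphism
  haveI : IsIso (j.app (p.1 : W.Opens)) := j.isIso_app _ p.2
  have happ : j.appLE (Uc p) (Vc p) (hVU p) = j.app (p.1 : W.Opens) := (Scheme.Hom.app_eq_appLE j).symm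
  let e₀ : Γ(W, (Uc p : W.Opens)) ≃+* Γ(U, (Vc p : U.Opens)) :=
    (asIso (j.app (p.1 : W.Opens))).commRingCatIsoToRingEquiv
  have he₀ : ∀ a, e₀ a = (j.appLE (Uc p) (Vc p) (hVU p)).hom a := fun a => by rw [happ]; rfl
  have hK : ∀ c : K, e₀ (algebraMap K Γ(W, (Uc p : W.Opens)) c) = algebraMap K Γ(U, (Vc p : U.Opens)) c :=
    fun c => by rw [he₀]; exact appLE_sectionsHom φ j (Uc p) (Vc p) (hVU p) c
  let e : Γ(W, (Uc p : W.Opens)) ≃ₐ[K] Γ(U, (Vc p : U.Opens)) := AlgEquiv.ofRingEquiv (f := e₀) hK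
  refine map_diffIdeal_le_of_algEquiv_comp K (RingHom.id _) _ e (fun a => he₀ a) ?_
  rw [Ideal.map_id, Ideal.map_id]

end Sheaf

/-! ## Order drop at a point -/

section Order

variable {K : Type v} [Field K] {X : Scheme.{u}} {φ : K →+* Γ(X, ⊤)}

/-- **`ord_x Diff^{≤n}(𝓘) ≥ ord_x 𝓘 − n`**: if `ord_x 𝓘 ≥ b` then `ord_x Diff^{≤n}(𝓘) ≥ b − n` (finite-type sections
over the field `K`; `Diff^{≤n}(𝓘)_x = Diff^{≤n}(𝓘_x) ⊆ 𝔪_x^{b−n}`). In particular a centre inside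
`{ord 𝓘 ≥ b}` lies inside `{ord Diff^{≤n}(𝓘) ≥ b − n}`.
[cite: VillamayorU2008ReesDiff, §4.1 (V(Diff^{b−1}(I)) = points of order ≥ b; Diff lowers order by at most n)] -/
theorem natCast_sub_le_idealOrder_diffIdealSheaf (hX : HasFiniteTypeSections φ) (n : ℕ) (I : X.IdealSheafData)
    {x : X} {b : ℕ} (h : (b : ℕ∞) ≤ idealOrder I x) :
    ((b - n : ℕ) : ℕ∞) ≤ idealOrder (diffIdealSheaf φ n I) x := by
  rw [le_idealOrder_iff] at h ⊢
  rw [stalkIdeal_diffIdealSheaf hX]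
  letI := stalkAlgebra φ x
  exact diffIdeal_le_pow_sub K h n

end Order

end Literature.AlgebraicGeometry.Resolution

end
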